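import Literature.AnabelianGeometry.EtaleTheta.FreeProfinitePermBasis
import HarnessLib

/-!
# Retractions of a free profinite group onto the closed subgroup generated by a sub-basis;
# `cl⟨Y₁⟩ ∩ cl⟨Y₂⟩ = cl⟨Y₁ ∩ Y₂⟩`; (PBF) ⟸ (PBF) for cyclic groups (PL3-TREEFREE §3.2 (i))

THEOREMS ONLY (v3: no definition is declared).  `exists_retractHat`: a family of retractions `r Y : F̂(S) → F̂(S)` (the
completions of the letter-killing endomorphisms of `FreeGroup S`, built inside the proof) with `r Y = id` on `clGen Y`,
values in `clGen Y`, `r Y₂ ∘ r Y₁ = r (Y₁ ∩ Y₂)`; hence `clGen_inter : clGen Y₁ ∩ clGen Y₂ = clGen (Y₁ ∩ Y₂)` and its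
finite-intersection forms; `permHat` is an action on all of `F̂(S)`; and
`permBasisFixedPoints_of_cyclic : PermBasisFixedPointsCyclic → PermBasisFixedPoints` (`Fix(Q) = ⋂_{σ∈Q} Fix(σ)`).
Background: Ribes–Zalesskii, *Profinite Groups*, §3.2 (profinite completion, functoriality, density)
[cite: RibesZalesskii2010, §3.2]; the `clGen`/(PBF) statements are statements of the ROUTE-PBF P-chain (this packet).

HONEST FRAMING. Classical profinite group theory (free profinite groups as completions of free groups, free profinite
products of finite groups as completions of free products); theorems only, no named-fact hypothesis; the four candidate `Prop`s of
`FreeProfinitePermBasis.lean` are all PROVED in this packet (`_holds`); no (E)-class module and no `SettingModel*` file is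
imported; nothing of [EtTh]/[IUTchII]/[IUTchIII] in print is asserted; CELL hextΔ/hΘ UNDECIDED-AT-MODEL; no side is taken on
[IUTchIII] Cor. 3.12; nothing here says abc is proved or refuted.  abc-iut cell, programme P-L2, rung (L3′), ROUTE-PBF,
P-chain (seat abc-iut-w6-d081 GEN 23; v3 GEN 24); desk: PL3-TREEFREE (abc-iut-L6-t19 g22) + PL3-PBF-READ (this seat).
-/

namespace Literature.AnabelianGeometry.EtaleTheta.SettingModel.TreeFree

open CategoryTheory Topology
open Literature.IUT.HodgeTheaters (profiniteCompletion toCompletion)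

universe u

variable {S : Type u}

/-! ### `clGen`: closedness, monotonicity, `clGen univ` -/

/-- `clGen Y` is closed (it is a closure). [cite: RibesZalesskii2010, §3.2] -/
theorem isClosed_clGen (Y : Set S) : IsClosed (clGen Y) := isClosed_closure

/-- `clGen` is monotone. [cite: RibesZalesskii2010, §3.2] -/
theorem clGen_mono {Y₁ Y₂ : Set S} (h : Y₁ ⊆ Y₂) : clGen Y₁ ⊆ clGen Y₂ :=
  closure_mono (Set.image_mono (Subgroup.closure_mono (Set.image_mono h)))

/-- `clGen univ = univ` (density of `η`). [cite: RibesZalesskii2010, §3.2] -/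
theorem clGen_univ : clGen (Set.univ : Set S) = Set.univ := by
  have hdense : DenseRange (toCompletion (FreeGroup S)) :=
    ProfiniteGrp.ProfiniteCompletion.denseRange (GrpCat.of (FreeGroup S))
  have htop : (Subgroup.closure (FreeGroup.of '' (Set.univ : Set S)) : Set (FreeGroup S)) = Set.univ := by
    rw [Set.image_univ, FreeGroup.closure_range_of, Subgroup.coe_top]
  rw [clGen, htop, Set.image_univ]
  exact hdense.closure_range

/-! ### The letter-killing retractions (construction inside one existence theorem; no definition is declared) -/

/-- **Retractions onto sub-basis closures.**  There is a family `r Y : F̂(S) → F̂(S)` (`Y ⊆ S`) with `r Y = id` on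
`clGen Y`, `r Y` valued in `clGen Y`, and `r Y₂ ∘ r Y₁ = r (Y₁ ∩ Y₂)`.  Construction (inside the proof): `r Y` is the
profinite completion of the letter-killing endomorphism `k_Y` of `FreeGroup S` (`s ↦ s` for `s ∈ Y`, `s ↦ 1` otherwise);
the three properties hold on the dense image of `FreeGroup S` (`k_Y = id` on `⟨Y⟩`, `k_Y` valued in `⟨Y⟩`,
`k_{Y₂} ∘ k_{Y₁} = k_{Y₁ ∩ Y₂}` letter by letter) and pass to `F̂(S)` by continuity.  Statement of the ROUTE-PBF P-chain
(this packet); cf. Ribes–Zalesskii, *Profinite Groups*, §3.2 (functoriality of the completion).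
[cite: RibesZalesskii2010, §3.2] -/
theorem exists_retractHat :
    ∃ r : Set S → profiniteCompletion (FreeGroup S) → profiniteCompletion (FreeGroup S),
      (∀ (Y : Set S) (w : profiniteCompletion (FreeGroup S)), w ∈ clGen Y → r Y w = w) ∧
      (∀ (Y : Set S) (w : profiniteCompletion (FreeGroup S)), r Y w ∈ clGen Y) ∧
      (∀ (Y₁ Y₂ : Set S) (w : profiniteCompletion (FreeGroup S)), r Y₂ (r Y₁ w) = r (Y₁ ∩ Y₂) w) := by
  classical
  -- the discrete letter-killing endomorphisms
  let k : Set S → (FreeGroup S →* FreeGroup S) := fun Y =>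
    FreeGroup.lift fun s => if s ∈ Y then FreeGroup.of s else 1
  have k_of_mem : ∀ {Y : Set S} {s : S}, s ∈ Y → k Y (FreeGroup.of s) = FreeGroup.of s := fun {Y s} hs => by
    simp [k, hs]
  have k_of_not_mem : ∀ {Y : Set S} {s : S}, s ∉ Y → k Y (FreeGroup.of s) = 1 := fun {Y s} hs => by
    simp [k, hs]
  have k_apply_of_mem : ∀ {Y : Set S} {w : FreeGroup S}, w ∈ Subgroup.closure (FreeGroup.of '' Y) → k Y w = w := by
    intro Y w hw
    induction hw using Subgroup.closure_induction with
    | mem x hx =>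
      obtain ⟨s, hs, rfl⟩ := hx
      exact k_of_mem hs
    | one => simp
    | mul x y _ _ hx hy => rw [map_mul, hx, hy]
    | inv x _ hx => rw [map_inv, hx]
  have k_mem : ∀ (Y : Set S) (w : FreeGroup S), k Y w ∈ Subgroup.closure (FreeGroup.of '' Y) := by
    intro Y w
    induction w using FreeGroup.induction_on with
    | C1 => simp
    | of s =>
      by_cases hs : s ∈ Y
      · rw [k_of_mem hs]; exact Subgroup.subset_closure ⟨s, hs, rfl⟩
      · rw [k_of_not_mem hs]; exact one_mem _
    | inv_of s ih => rw [map_inv]; exact inv_mem ih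
    | mul x y hx hy => rw [map_mul]; exact mul_mem hx hy
  have k_k : ∀ (Y₁ Y₂ : Set S) (w : FreeGroup S), k Y₂ (k Y₁ w) = k (Y₁ ∩ Y₂) w := by
    intro Y₁ Y₂ w
    induction w using FreeGroup.induction_on with
    | C1 => simp
    | of s =>
      by_cases h1 : s ∈ Y₁ <;> by_cases h2 : s ∈ Y₂ <;>
        simp [k_of_mem, k_of_not_mem, h1, h2, Set.mem_inter_iff]
    | inv_of s ih => simp only [map_inv, ih]
    | mul x y hx hy => simp only [map_mul, hx, hy]
  -- their completions
  let r : Set S → (profiniteCompletion (FreeGroup S) →* profiniteCompletion (FreeGroup S)) := fun Y =>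
    (ProfiniteGrp.profiniteCompletion.map (GrpCat.ofHom (k Y))).hom.toMonoidHom
  have r_cont : ∀ Y, Continuous (r Y) := fun Y =>
    (ProfiniteGrp.profiniteCompletion.map (GrpCat.ofHom (k Y))).hom.continuous_toFun
  have r_eta : ∀ (Y : Set S) (w : FreeGroup S),
      r Y (toCompletion (FreeGroup S) w) = toCompletion (FreeGroup S) (k Y w) := fun Y w =>
    Literature.IUT.HodgeTheaters.ProfiniteCompletion.profiniteCompletionMap_toCompletion _ w
  have hdense : DenseRange (toCompletion (FreeGroup S)) :=
    ProfiniteGrp.ProfiniteCompletion.denseRange (GrpCat.of (FreeGroup S))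
  refine ⟨fun Y w => r Y w, ?_, ?_, ?_⟩
  · -- identity on `clGen Y`: closed condition, true on the dense part `η⟨Y⟩`
    intro Y w hw
    have hcl : IsClosed {v : profiniteCompletion (FreeGroup S) | r Y v = v} :=
      isClosed_eq (r_cont Y) continuous_id
    have hsub : toCompletion (FreeGroup S) '' (Subgroup.closure (FreeGroup.of '' Y) : Set (FreeGroup S)) ⊆
        {v | r Y v = v} := by
      rintro _ ⟨x, hx, rfl⟩
      show r Y (toCompletion (FreeGroup S) x) = toCompletion (FreeGroup S) x
      rw [r_eta, k_apply_of_mem hx]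
    exact hcl.closure_subset_iff.mpr hsub hw
  · -- values in `clGen Y`: closed condition, true on the dense `η(FreeGroup S)`
    intro Y w
    have hcl : IsClosed {v : profiniteCompletion (FreeGroup S) | r Y v ∈ clGen Y} :=
      (isClosed_clGen Y).preimage (r_cont Y)
    have hsub : Set.range (toCompletion (FreeGroup S)) ⊆ {v | r Y v ∈ clGen Y} := by
      rintro _ ⟨x, rfl⟩
      show r Y (toCompletion (FreeGroup S) x) ∈ clGen Y
      rw [r_eta]
      exact subset_closure ⟨k Y x, k_mem Y x, rfl⟩
    have huniv : {v : profiniteCompletion (FreeGroup S) | r Y v ∈ clGen Y} = Set.univ := by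
      apply Set.eq_univ_of_univ_subset
      rw [← hdense.closure_range]
      exact hcl.closure_subset_iff.mpr hsub
    have : w ∈ {v : profiniteCompletion (FreeGroup S) | r Y v ∈ clGen Y} := by rw [huniv]; trivial
    exact this
  · -- composition: continuous maps agreeing on the dense image
    intro Y₁ Y₂ w
    have h := Literature.IUT.HodgeTheaters.ProfiniteCompletion.eq_of_forall_toCompletion
      (ψ₁ := fun v => r Y₂ (r Y₁ v)) (ψ₂ := fun v => r (Y₁ ∩ Y₂) v)
      ((r_cont Y₂).comp (r_cont Y₁)) (r_cont _)
      (fun g => by simp only [r_eta, k_k])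
    exact congrFun h w

/-- **`cl⟨Y₁⟩ ∩ cl⟨Y₂⟩ ⊆ cl⟨Y₁ ∩ Y₂⟩`** in the free profinite group `F̂(S)`: `w = r_{Y₂} w = r_{Y₂} r_{Y₁} w =
r_{Y₁∩Y₂} w ∈ clGen (Y₁ ∩ Y₂)` for the retractions of `exists_retractHat`. (The reverse inclusion is `clGen_mono`.)
Statement of the ROUTE-PBF P-chain (this packet); cf. Ribes–Zalesskii §3.2. [cite: RibesZalesskii2010, §3.2] -/
theorem mem_clGen_inter {Y₁ Y₂ : Set S} {w : profiniteCompletion (FreeGroup S)}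
    (h₁ : w ∈ clGen Y₁) (h₂ : w ∈ clGen Y₂) : w ∈ clGen (Y₁ ∩ Y₂) := by
  obtain ⟨r, hr_id, hr_mem, hr_comp⟩ := exists_retractHat (S := S)
  have e : w = r (Y₁ ∩ Y₂) w := by
    conv_lhs => rw [← hr_id Y₂ w h₂, ← hr_id Y₁ w h₁]
    exact hr_comp Y₁ Y₂ w
  rw [e]
  exact hr_mem _ w

/-- `cl⟨Y₁⟩ ∩ cl⟨Y₂⟩ = cl⟨Y₁ ∩ Y₂⟩`. [cite: RibesZalesskii2010, §3.2] -/
theorem clGen_inter (Y₁ Y₂ : Set S) : clGen Y₁ ∩ clGen Y₂ = clGen (Y₁ ∩ Y₂) :=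
  Set.Subset.antisymm (fun _ h => mem_clGen_inter h.1 h.2)
    (Set.subset_inter (clGen_mono Set.inter_subset_left) (clGen_mono Set.inter_subset_right))

/-- Finite intersections: `(∀ i ∈ I, w ∈ clGen (Y i)) → w ∈ clGen (⋂ i ∈ I, Y i)` for a `Finset I`. [cite: RibesZalesskii2010, §3.2] -/
theorem mem_clGen_biInter_finset {ι : Type*} (I : Finset ι) (Y : ι → Set S)
    {w : profiniteCompletion (FreeGroup S)} (h : ∀ i ∈ I, w ∈ clGen (Y i)) :
    w ∈ clGen (⋂ i ∈ I, Y i) := by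
  classical
  induction I using Finset.induction_on with
  | empty =>
    simp only [Finset.notMem_empty, Set.iInter_of_empty, Set.iInter_univ]
    rw [clGen_univ]; trivial
  | insert a I ha ih =>
    rw [Finset.set_biInter_insert]
    exact mem_clGen_inter (h a (Finset.mem_insert_self a I))
      (ih fun i hi => h i (Finset.mem_insert_of_mem hi))

/-- Finite intersections, `Finite ι` form. [cite: RibesZalesskii2010, §3.2] -/
theorem mem_clGen_iInter {ι : Type*} [Finite ι] (Y : ι → Set S)
    {w : profiniteCompletion (FreeGroup S)} (h : ∀ i, w ∈ clGen (Y i)) : w ∈ clGen (⋂ i, Y i) := by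
  haveI := Fintype.ofFinite ι
  have := mem_clGen_biInter_finset (Finset.univ : Finset ι) Y (w := w) (fun i _ => h i)
  simpa only [Finset.mem_univ, Set.iInter_true] using this

/-! ### (PBF) ⟸ (PBF) for cyclic groups -/

/-- **Reduction (i) of PL3-TREEFREE §3.2**: (PBF) for every finite permutation group follows from (PBF) for cyclic
groups, by `Fix(Q) = ⋂_{σ∈Q} Fix(σ)` and `⋂_{σ ∈ Q} cl⟨S^σ⟩ = cl⟨S^Q⟩` (`mem_clGen_iInter`, `Q` finite as
`S` is finite).  Statement of the ROUTE-PBF P-chain (this packet); cf. Ribes–Zalesskii §3.2. [cite: RibesZalesskii2010, §3.2] -/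
theorem permBasisFixedPoints_of_cyclic (h : PermBasisFixedPointsCyclic.{u}) : PermBasisFixedPoints.{u} := by
  intro S _ Q w hw
  haveI : Finite Q := inferInstance
  have hmem : w ∈ clGen (⋂ σ : Q, {s : S | (σ : Equiv.Perm S) s = s}) :=
    mem_clGen_iInter (fun σ : Q => {s : S | (σ : Equiv.Perm S) s = s}) fun σ => h S σ w (hw σ σ.2)
  have hset : (⋂ σ : Q, {s : S | (σ : Equiv.Perm S) s = s}) = {s : S | ∀ σ ∈ Q, σ s = s} := by
    ext s
    simp only [Set.mem_iInter, Set.mem_setOf_eq, Subtype.forall]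
  rw [hset] at hmem
  exact hmem

/-! ### `permHat` as an action on all of `F̂(S)` -/

/-- `permHat (σ * τ) = permHat σ ∘ permHat τ` on all of `F̂(S)` (continuous, equal on the dense image). [cite: RibesZalesskii2010, §3.2] -/
theorem permHat_mul_apply (σ τ : Equiv.Perm S) (w : profiniteCompletion (FreeGroup S)) :
    permHat (σ * τ) w = permHat σ (permHat τ w) := by
  have h := Literature.IUT.HodgeTheaters.ProfiniteCompletion.eq_of_forall_toCompletion
    (ψ₁ := fun v => permHat (σ * τ) v) (ψ₂ := fun v => permHat σ (permHat τ v))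
    (continuous_permHat _) ((continuous_permHat σ).comp (continuous_permHat τ))
    (fun g => by simp only [permHat_toCompletion, Equiv.Perm.coe_mul, FreeGroup.map.comp])
  exact congrFun h w

/-- `permHat 1 = id`. [cite: RibesZalesskii2010, §3.2] -/
theorem permHat_one_apply (w : profiniteCompletion (FreeGroup S)) : permHat (1 : Equiv.Perm S) w = w := by
  have h := Literature.IUT.HodgeTheaters.ProfiniteCompletion.eq_of_forall_toCompletion
    (ψ₁ := fun v => permHat (1 : Equiv.Perm S) v) (ψ₂ := fun v => v)
    (continuous_permHat _) continuous_id
    (fun g => by simp only [permHat_toCompletion, Equiv.Perm.coe_one, FreeGroup.map.id])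
  exact congrFun h w

/-- A `σ`-fixed element is fixed by every power of `σ`. [cite: RibesZalesskii2010, §3.2] -/
theorem permHat_pow_apply_of_fixed (σ : Equiv.Perm S) {w : profiniteCompletion (FreeGroup S)}
    (hw : permHat σ w = w) (n : ℕ) : permHat (σ ^ n) w = w := by
  induction n with
  | zero => rw [pow_zero]; exact permHat_one_apply w
  | succ n ih => rw [pow_succ, permHat_mul_apply, hw, ih]


end Literature.AnabelianGeometry.EtaleTheta.SettingModel.TreeFree
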